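import Literature.NumberTheory.EllipticCurves.RingClassFieldTower
import Literature.NumberTheory.QuadraticFields.RingClassConjugatePrimeClass
import Literature.NumberTheory.ComplexMultiplication.CMLatticeRingClassTowerRamified
import Mathlib.NumberTheory.RamificationInertia.Galois
import HarnessLib

/-!
# `stub_auxiliaryInertLevelAtThree`, ideal side: `D · ord[𝔭_v]_m ∣ ord[𝔭_v]_{ℓm}` as soon as the image
# of a generator `β` of `𝔭_v^A` (up to `ℚ^×`) in `F_{ℓ²}^× / F_ℓ^×` has order divisible by `D`
# (Cox §7.D (7.27); Gross 1991 §3, `G_ℓ ≃ F_λ^×/F_ℓ^×`)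

Crux `stmt-BirchSwinnertonDyer-19109` (`EulerHalvesAtThree`), line `inert` (tam3-p1 g18), registered stub
`stub_auxiliaryInertLevelAtThree`.  The companion file `…AuxInertLevelStabilizer` (p646235) reduced the
stub's Galois-theoretic conclusion (`σ^{ℓ₀+1} = 1`, `3^e ∣ #Stab_{⟨σ⟩}(w̃)`) to the ring-class-group
statement `∀ v ∋ q, 3^e · ord[𝔭_v]_{m₀} ∣ ord[𝔭_v]_{ℓ₀m₀}`.  This file proves the IDEAL-THEORETIC half:
that statement follows from an elementary congruence property of ONE element `β ∈ 𝓞_K` attached to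
`(𝔮, m₀)` BEFORE `ℓ₀` is chosen — *every `d` with `β^d ≡ a (mod ℓ₀𝓞_K)`, `a ∈ ℤ`, is divisible by `3^e`*
— which is what the Chebotarev choice of `ℓ₀` (the remaining, analytic part of the stub) delivers.

* `mul_orderOf_primeClass_dvd` — the growth theorem (docstring there);
* `exists_pow_mul_span_eq_span` — the generator `β`: `[𝔭_v]_f^A = 1 ⟹ 𝔭_v^A (t) = (β)`, `t ∈ ℤ_{>0}`
  prime to `f`;
* `orderOf_primeClass_eq_of_smul`, `exists_eq_smul_of_natCast_mem`, `forall_mul_orderOf_dvd_of_one` — the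
  order condition at ONE prime `𝔮 ∋ q` gives it at every prime above `q` (`[σ𝔮] = [𝔮]⁻¹`);
* plumbing (`𝒪_K^× = ±1` from `#𝒪_K^× = 2` is cm-revival's `units_eq_one_or_neg_one_of_natCard_eq_two`): `idealClass_congr`,
  `idealClass_pow`, `pow_sup_span_eq_top`, `prin_congr`, `prin_pow`, `not_span_le_of_natCast_mem`.

What remains of the stub after this file and its companion (NOT claimed here; hand-verified in the
line's STUB-PLAN, evidence on the crux item): the CHEBOTAREV SUPPLY — for `W` with `ρ̄_{E,3}` onto,
`K` imaginary quadratic with `d_K < −4`, `q` split, `𝔮 ∋ q`, `A ≥ 1`, `t ≥ 1`, `𝔮^A (t) = (β)`, a finite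
set `S` of primes and `e ≥ 0`: a prime `ℓ ∉ S`, inert in `K`, with `3 ∤ a_ℓ(E)` and
`∀ d, (∃ a ∈ ℤ, β^d ≡ a (mod ℓ𝓞_K)) → 3^e ∣ d` (Frobenius in `K(μ_{3^{e+k}}, E[3], γ₀^{1/3})/ℚ`,
`β/β̄ = γ₀^{3^k}`, `γ₀ ∉ K^{×3}`).  HONEST FRAMING: helper lemmas toward one registered stub of one
line of crux 19109; the crux stays open; BSD is proved for no curve here.

## References

* D. A. Cox, *Primes of the form x² + ny²*, 2nd ed. (2013): §7.A, §7.B, §7.C (Props. 7.20, 7.22,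
  `I_K(f)`, `P_{K,ℤ}(f)`), §7.D ((7.27), Exercise 7.30), §9.A (Lemma 9.3). [Cox2013]
* B. H. Gross, *Kolyvagin's work on modular elliptic curves*, LMS LNS 153 (1991), §1 (`𝒪^× = ±1`),
  §3 (p. 239: `G_ℓ ≃ F_λ^×/F_ℓ^×` cyclic of order `ℓ + 1`). [GrossLMS1991]
* D. A. Marcus, *Number Fields*, 2nd ed. (2018), Ch. 3, Thm. 23. [Marcus2018]

## Mathlib / tree search

Tree (imported, reused by name): `RingClass.RingClassGroup`, `prin`, `prin_mul`, `prin_one`, `prin_eq_mk0`,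
`prin_mem_ringClassNum`, `exists_eq_mul_inv_of_mem_ringClassDen`, `cj`, `nm`, `mul_cj`,
`isCoprime_nm_of_isUnit`, `theta`, `theta_eq`, `ne_zero_of_isCoprime`, `span_sup_eq_top_of_sub_mem`
(`QuadraticFields/RingClassGroup`); `theta_eq_one_iff`, `isUnit_mk_of_sup_eq_top`, `mul_sup_eq_top`,
`finite_ringClassGroup` (`RingClassNumber`); `nm_pos` (`RingClassUnits`); `RingClass.restrict`,
`span_natCast_le_of_dvd`, `span_natCast_ne_top_of_ne_one` (`RingClassGroupTower`);
`RingClassField.idealClass`, `idealClass_eq`, `idealClass_mul`, `idealClass_span_eq`,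
`idealClass_span_eq_one`, `primeClass`, `primeClass_of_sup_eq_top`, `sup_span_eq_top_iff_not_le`
(`NumberFields/RingClassFieldOfConductor`); `restrict_primeClass`, `card_units_eq_two_of_discr_lt`,
`exists_basis_zero_eq_one`, `basis_one_mul_self_eq`, `discr_eq_sq_add_four_mul` (`RingClassFieldTower`
& deps); `RingClass.primeClass_mul_primeClass_eq_one_of_smul` (`RingClassConjugatePrimeClass`);
`CMTypeLattice.units_eq_one_or_neg_one_of_natCard_eq_two` (`ComplexMultiplication/CMLatticeRingClassTowerRamified`).
Mathlib: `orderOf_pow'`, `orderOf_map_dvd`, `orderOf_dvd_of_pow_eq_one`, `orderOf_inv`,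
`Ideal.exists_smul_eq_of_isGaloisGroup`, `FractionalIdeal.coeIdeal_inj`, `SubmonoidClass.mk_pow`.
`lean search 'orderOf.*primeClass.*dvd|primeClass.*pow.*span'` (2026-08-28): only er5-w4's
`orderOf_primeClass_dvd_of_dvd` (`ord_m ∣ ord_n`), no growth statement.
-/

noncomputable section

set_option autoImplicit false
set_option linter.dupNamespace false

open scoped nonZeroDivisors NumberField Pointwise
open IsDedekindDomain IsDedekindDomain.HeightOneSpectrum Module NumberField

namespace Summit.BirchSwinnertonDyer.BirchSwinnertonDyer.Theorems.AuxInertLevel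

open Literature.NumberTheory.EllipticCurves
open Literature.NumberTheory.NumberFields Literature.NumberTheory.NumberFields.RingClassField
open Literature.NumberTheory.QuadraticFields.RingClass
open Literature.NumberTheory.QuadraticFields.Quadratic

variable {K : Type} [Field K] [NumberField K]

/-! ## §1 Plumbing: classes of powers, principal units -/

/-- Transport of the class `[𝔞] ∈ I_K(f)/P_{K,ℤ}(f)` along an equality of ideals (the proof arguments of
`idealClass` depend on the ideal). [cite: Cox2013, §7.C Prop. 7.22] -/
theorem idealClass_congr (f : ℕ) {I J : Ideal (𝓞 K)} (h : I = J) (hI : I ≠ ⊥)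
    (hIc : I ⊔ Ideal.span {(f : 𝓞 K)} = ⊤) (hJ : J ≠ ⊥) (hJc : J ⊔ Ideal.span {(f : 𝓞 K)} = ⊤) :
    idealClass f hI hIc = idealClass f hJ hJc := by
  subst h
  rfl

/-- **`[𝔞^d] = [𝔞]^d`** in `I_K(f)/P_{K,ℤ}(f)`. [cite: Cox2013, §7.C Prop. 7.20 and Prop. 7.22] -/
theorem idealClass_pow (f : ℕ) {I : Ideal (𝓞 K)} (hI : I ≠ ⊥) (hIc : I ⊔ Ideal.span {(f : 𝓞 K)} = ⊤)
    (d : ℕ) (hId : I ^ d ≠ ⊥) (hIdc : I ^ d ⊔ Ideal.span {(f : 𝓞 K)} = ⊤) :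
    idealClass f hId hIdc = idealClass f hI hIc ^ d := by
  rw [idealClass_eq, idealClass_eq, ← QuotientGroup.mk_pow]
  congr 1
  apply Subtype.ext
  change FractionalIdeal.mk0 K ⟨I ^ d, mem_nonZeroDivisors_of_ne_bot hId⟩ =
    FractionalIdeal.mk0 K ⟨I, mem_nonZeroDivisors_of_ne_bot hI⟩ ^ d
  rw [← map_pow]
  congr 1

omit [NumberField K] in
/-- A power of an ideal prime to `f` is prime to `f`. [cite: Cox2013, §7.C Lemma 7.18] -/
theorem pow_sup_span_eq_top {f : ℕ} {I : Ideal (𝓞 K)} (hIc : I ⊔ Ideal.span {(f : 𝓞 K)} = ⊤) (d : ℕ) :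
    I ^ d ⊔ Ideal.span {(f : 𝓞 K)} = ⊤ := by
  rw [← Ideal.isCoprime_iff_sup_eq] at hIc ⊢
  exact IsCoprime.pow_left hIc

/-- Transport of the unit `prin K α = α𝓞_K` along an equality of elements. [cite: Cox2013, §7.A (P(𝒪))] -/
theorem prin_congr {α α' : 𝓞 K} (h : α = α') (hα : α ≠ 0) (hα' : α' ≠ 0) :
    prin K α hα = prin K α' hα' := by
  subst h
  rfl

/-- **`(α^d)𝓞_K = (α𝓞_K)^d`** as units of fractional ideals. [cite: Cox2013, §7.A (P(𝒪))] -/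
theorem prin_pow (β : 𝓞 K) (hβ : β ≠ 0) :
    ∀ d : ℕ, prin K (β ^ d) (pow_ne_zero d hβ) = prin K β hβ ^ d
  | 0 => (prin_congr (pow_zero β) _ one_ne_zero).trans (prin_one.trans (pow_zero _).symm)
  | d + 1 => (prin_congr (pow_succ β d) _ (mul_ne_zero (pow_ne_zero d hβ) hβ)).trans
      ((prin_mul _ _ _ _).trans (by rw [prin_pow β hβ d, pow_succ]))

/-! ## §2 The growth of `ord[𝔭_v]` from `Cl(m)` to `Cl(ℓm)` -/

/-- **The ideal side of `stub_auxiliaryInertLevelAtThree`: growth of the order of a prime class in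
the ring class tower `Cl(ℓm) → Cl(m)`.**  Let `K` be imaginary quadratic with `d_K < −4` (`𝒪_K^× = ±1`),
`ℓ` a prime, `n = ℓm`, `v ∤ n` a prime of `K`, `A` with `[𝔭_v]_m^A = 1`, and `β ∈ 𝓞_K`, `t ∈ ℤ` prime to
`n` with `𝔭_v^A · (t) = (β)` (such `β, t` exist: `exists_pow_mul_span_eq_span`).  If every `d` with
`β^d ≡ a (mod ℓ𝓞_K)` for some `a ∈ ℤ` is divisible by `D`, then **`D · ord[𝔭_v]_m ∣ ord[𝔭_v]_{ℓm}`**.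
Proof (Cox §7.D (7.27), Gross §3): `[𝔭_v]_n^A = [β𝓞_K]_n = θ_n(β)` (`t ∈ ℤ` dies in `P_{K,ℤ}(n)`);
if `θ_n(β)^d = θ_n(β^d) = 1` then `β^d ≡ εa (mod n)` with `ε ∈ 𝒪_K^× = {±1}`, `a ∈ ℤ`
(`theta_eq_one_iff`), so `β^d ≡ ±a (mod ℓ)` and `D ∣ d`; hence `D ∣ ord([𝔭_v]_n^A) = ord[𝔭_v]_n / gcd`,
and `ord[𝔭_v]_m ∣ gcd(ord[𝔭_v]_n, A)` (`restrict_primeClass`).  For the stub: `D = 3^e`, and the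
hypothesis says *the image of `β` in `F_{ℓ²}^×/F_ℓ^× ≅ ker(Cl(ℓm) → Cl(m))` has order divisible by
`3^e`* — what the Chebotarev choice of `ℓ` delivers.
[cite: Cox2013, §7.D (7.27), Exercise 7.30] [cite: GrossLMS1991, §3 (p. 239: G_ℓ ≃ F_λ^×/F_ℓ^×)] -/
theorem mul_orderOf_primeClass_dvd (hK : IsImaginaryQuadratic K) (hd : NumberField.discr K < -4)
    {ℓ m : ℕ} (hℓ : ℓ.Prime)
    {v : HeightOneSpectrum (𝓞 K)} (hv : ¬ Ideal.span {((ℓ * m : ℕ) : 𝓞 K)} ≤ v.asIdeal)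
    {A : ℕ} (hA : primeClass m v ^ A = 1)
    {β : 𝓞 K} {t : ℤ} (ht : IsCoprime t ((ℓ * m : ℕ) : ℤ))
    (hβ : v.asIdeal ^ A * Ideal.span {(t : 𝓞 K)} = Ideal.span {β})
    {D : ℕ} (hD : ∀ d : ℕ, (∃ a : ℤ, β ^ d - (a : 𝓞 K) ∈ Ideal.span {(ℓ : 𝓞 K)}) → D ∣ d) :
    D * orderOf (primeClass m v) ∣ orderOf (primeClass (ℓ * m) v) := by
  classical
  -- basis data for Cox's `θ`, units `±1`
  obtain ⟨b, hb⟩ := exists_basis_zero_eq_one hK.1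
  have hω := basis_one_mul_self_eq b hb
  have hn1 : ℓ * m ≠ 1 := fun h => hℓ.one_lt.ne' (Nat.eq_one_of_mul_eq_one_right h)
  have hfn : Ideal.span {((ℓ * m : ℕ) : 𝓞 K)} ≠ ⊤ := span_natCast_ne_top_of_ne_one b hb hn1
  have hunits : Nat.card (𝓞 K)ˣ = 2 := card_units_eq_two_of_discr_lt hK hd
  -- coprimality bookkeeping
  have hvn : v.asIdeal ⊔ Ideal.span {((ℓ * m : ℕ) : 𝓞 K)} = ⊤ := (sup_span_eq_top_iff_not_le _).mpr hv
  have hvA : v.asIdeal ^ A ⊔ Ideal.span {((ℓ * m : ℕ) : 𝓞 K)} = ⊤ := pow_sup_span_eq_top hvn A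
  have ht0' : t ≠ 0 := ne_zero_of_isCoprime hfn ht
  have ht0 : (t : 𝓞 K) ≠ 0 := by exact_mod_cast ht0'
  have htc : Ideal.span {(t : 𝓞 K)} ⊔ Ideal.span {((ℓ * m : ℕ) : 𝓞 K)} = ⊤ :=
    span_sup_eq_top_of_sub_mem ht (by rw [sub_self]; exact Submodule.zero_mem _)
  have hprod : v.asIdeal ^ A * Ideal.span {(t : 𝓞 K)} ⊔ Ideal.span {((ℓ * m : ℕ) : 𝓞 K)} = ⊤ :=
    mul_sup_eq_top hvA htc
  have hβc : Ideal.span {β} ⊔ Ideal.span {((ℓ * m : ℕ) : 𝓞 K)} = ⊤ := hβ ▸ hprod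
  have hβ0 : β ≠ 0 := by
    intro h
    rw [Ideal.span_singleton_eq_bot.mpr h, bot_sup_eq] at hβc
    exact hfn hβc
  have hvA0 : v.asIdeal ^ A ≠ ⊥ := pow_ne_zero A v.ne_bot
  have hspan0 : Ideal.span {(t : 𝓞 K)} ≠ ⊥ := by rwa [Ne, Ideal.span_singleton_eq_bot]
  -- `[𝔭_v]_n ^ A = [β𝓞 K]_n`
  have hxA : primeClass (ℓ * m) v ^ A =
      QuotientGroup.mk ⟨prin K β hβ0, prin_mem_ringClassNum hβ0 hβc⟩ := by
    rw [primeClass_of_sup_eq_top _ hvn, ← idealClass_pow (ℓ * m) v.ne_bot hvn A hvA0 hvA,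
      ← idealClass_span_eq (ℓ * m) hβ0 hβc,
      ← idealClass_congr (ℓ * m) hβ (mul_ne_zero hvA0 hspan0) hprod _ hβc,
      idealClass_mul (ℓ * m) hvA0 hspan0 hvA htc hprod,
      idealClass_span_eq_one (ℓ * m) ht0 ht (by rw [sub_self]; exact Submodule.zero_mem _) htc]
    exact (mul_one (idealClass (ℓ * m) hvA0 hvA)).symm
  -- `D ∣ orderOf ([𝔭_v]_n ^ A)`
  have hDd : D ∣ orderOf (primeClass (ℓ * m) v ^ A) := by
    apply hD
    obtain ⟨d, hd⟩ : ∃ d, orderOf (primeClass (ℓ * m) v ^ A) = d := ⟨_, rfl⟩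
    rw [hd]
    have h1 : (primeClass (ℓ * m) v ^ A) ^ d = 1 := hd ▸ pow_orderOf_eq_one _
    rw [hxA, ← QuotientGroup.mk_pow] at h1
    have hβd0 : β ^ d ≠ 0 := pow_ne_zero d hβ0
    have hβdc : Ideal.span {β ^ d} ⊔ Ideal.span {((ℓ * m : ℕ) : 𝓞 K)} = ⊤ := by
      rw [← Ideal.span_singleton_pow]; exact pow_sup_span_eq_top hβc d
    have h2 : (QuotientGroup.mk ⟨prin K (β ^ d) hβd0, prin_mem_ringClassNum hβd0 hβdc⟩ :
        RingClassGroup K (ℓ * m)) = 1 := by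
      rw [← h1]
      congr 1
      apply Subtype.ext
      rw [SubmonoidClass.mk_pow]
      exact prin_pow β hβ0 d
    have hu : IsUnit (Ideal.Quotient.mk (Ideal.span {((ℓ * m : ℕ) : 𝓞 K)}) (β ^ d)) :=
      isUnit_mk_of_sup_eq_top hβdc
    have h3 : theta K (ℓ * m) b hb hω hfn hu.unit = 1 := by
      rw [theta_eq b hb hω hfn hu.unit_spec.symm]
      exact h2
    obtain ⟨ε, a, -, hεa⟩ := (theta_eq_one_iff b hb hω hfn hu.unit).mp h3
    rw [hu.unit_spec] at hεa
    have h4 : β ^ d - (ε : 𝓞 K) * (a : 𝓞 K) ∈ Ideal.span {((ℓ * m : ℕ) : 𝓞 K)} :=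
      Ideal.Quotient.eq.mp hεa
    have h5 : β ^ d - (ε : 𝓞 K) * (a : 𝓞 K) ∈ Ideal.span {(ℓ : 𝓞 K)} :=
      span_natCast_le_of_dvd (dvd_mul_right ℓ m) h4
    rcases Literature.NumberTheory.ComplexMultiplication.CMTypeLattice.units_eq_one_or_neg_one_of_natCard_eq_two
      hunits ε with rfl | rfl
    · exact ⟨a, by simpa only [Units.val_one, one_mul] using h5⟩
    · refine ⟨-a, ?_⟩
      rw [Int.cast_neg]
      simpa only [Units.val_neg, Units.val_one, neg_one_mul] using h5
  -- combine: `ord y ∣ ord x`, `ord y ∣ A`, `ord (x^A) = ord x / gcd (ord x) A`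
  have hy : orderOf (primeClass m v) ∣ orderOf (primeClass (ℓ * m) v) := by
    rw [← restrict_primeClass (dvd_mul_left m ℓ) hv]
    exact orderOf_map_dvd _ _
  have hyA : orderOf (primeClass m v) ∣ A := orderOf_dvd_of_pow_eq_one hA
  by_cases hA0 : A = 0
  · subst hA0
    rw [pow_zero, orderOf_one, Nat.dvd_one] at hDd
    rw [hDd, one_mul]
    exact hy
  · rw [orderOf_pow' _ hA0] at hDd
    obtain ⟨c, hc⟩ := Nat.gcd_dvd_left (orderOf (primeClass (ℓ * m) v)) A
    have hgpos : 0 < Nat.gcd (orderOf (primeClass (ℓ * m) v)) A :=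
      Nat.gcd_pos_of_pos_right _ (Nat.pos_of_ne_zero hA0)
    have hdiv : orderOf (primeClass (ℓ * m) v) / Nat.gcd (orderOf (primeClass (ℓ * m) v)) A = c :=
      Nat.div_eq_of_eq_mul_left hgpos (hc.trans (mul_comm _ _))
    rw [hdiv] at hDd
    have hyg : orderOf (primeClass m v) ∣ Nat.gcd (orderOf (primeClass (ℓ * m) v)) A :=
      Nat.dvd_gcd hy hyA
    calc D * orderOf (primeClass m v) ∣ c * Nat.gcd (orderOf (primeClass (ℓ * m) v)) A :=
          mul_dvd_mul hDd hyg
      _ = orderOf (primeClass (ℓ * m) v) := by rw [mul_comm]; exact hc.symm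

/-! ## §3 The generator `β` and the primes above `q` -/

/-- **A generator for `𝔭_v^A` up to a rational factor**: if `[𝔭_v]_f^A = 1` in `I_K(f)/P_{K,ℤ}(f)`
(`K` imaginary quadratic, `v ∤ f`) then `𝔭_v^A · (t) = (β)` for some `β ∈ 𝓞_K` and an integer `t > 0`
prime to `f`: `𝔭_v^A ∈ P_{K,ℤ}(f)` is `(α)(γ)⁻¹` with `α ≡ a`, `γ ≡ c (mod f)` (Cox §7.C), and
`β = α γ̄`, `t = N(γ) = γ γ̄ > 0`, `gcd(N(γ), f) = 1`. [cite: Cox2013, §7.C (P_{K,ℤ}(f)), §7.D (7.27)] -/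
theorem exists_pow_mul_span_eq_span (hK : IsImaginaryQuadratic K) (f : ℕ)
    {v : HeightOneSpectrum (𝓞 K)} (hv : ¬ Ideal.span {(f : 𝓞 K)} ≤ v.asIdeal) {A : ℕ}
    (hA : primeClass f v ^ A = 1) :
    ∃ β : 𝓞 K, ∃ t : ℤ, 0 < t ∧ IsCoprime t (f : ℤ) ∧
      v.asIdeal ^ A * Ideal.span {(t : 𝓞 K)} = Ideal.span {β} := by
  classical
  obtain ⟨b, hb⟩ := exists_basis_zero_eq_one hK.1
  have hω := basis_one_mul_self_eq b hb
  have hdK := discr_eq_sq_add_four_mul b hb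
  have hneg : (b.repr (b 1 * b 1) 1) ^ 2 + 4 * (b.repr (b 1 * b 1) 0) < 0 := hdK ▸ hK.discr_neg
  have hvc : v.asIdeal ⊔ Ideal.span {(f : 𝓞 K)} = ⊤ := (sup_span_eq_top_iff_not_le f).mpr hv
  have hvA0 : v.asIdeal ^ A ≠ ⊥ := pow_ne_zero A v.ne_bot
  have hvAc : v.asIdeal ^ A ⊔ Ideal.span {(f : 𝓞 K)} = ⊤ := pow_sup_span_eq_top hvc A
  have h1 : idealClass f hvA0 hvAc = 1 := by
    rw [idealClass_pow f v.ne_bot hvc A hvA0 hvAc, ← primeClass_of_sup_eq_top f hvc, hA]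
  rw [idealClass_eq, QuotientGroup.eq_one_iff, Subgroup.mem_subgroupOf] at h1
  obtain ⟨s, ⟨α, a, ha, hαa, hs⟩, s', ⟨γ, c, hc, hγc, hs'⟩, hss'⟩ :=
    exists_eq_mul_inv_of_mem_ringClassDen h1
  rw [eq_mul_inv_iff_mul_eq] at hss'
  have hval := congrArg (fun u : (FractionalIdeal (𝓞 K)⁰ K)ˣ => (u : FractionalIdeal (𝓞 K)⁰ K)) hss'
  simp only [Units.val_mul, FractionalIdeal.coe_mk0, hs, hs'] at hval
  have hγ0 : γ ≠ 0 := by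
    rintro rfl
    have h0 : (s' : FractionalIdeal (𝓞 K)⁰ K) = 0 := by rw [hs']; simp
    exact s'.ne_zero h0
  have hideal : v.asIdeal ^ A * Ideal.span {γ} = Ideal.span {α} := by
    rw [← FractionalIdeal.coeIdeal_inj (K := K), FractionalIdeal.coeIdeal_mul,
      FractionalIdeal.coeIdeal_span_singleton, FractionalIdeal.coeIdeal_span_singleton]
    exact hval
  refine ⟨α * cj b (t := b.repr (b 1 * b 1) 1) γ,
    nm b (t := b.repr (b 1 * b 1) 1) (m := b.repr (b 1 * b 1) 0) γ, nm_pos b hneg hγ0,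
    isCoprime_nm_of_isUnit b hb hω (isUnit_mk_of_sup_eq_top (span_sup_eq_top_of_sub_mem hc hγc)),
    ?_⟩
  rw [← mul_cj b hb hω γ, ← Ideal.span_singleton_mul_span_singleton, ← mul_assoc, hideal,
    Ideal.span_singleton_mul_span_singleton]

/-- **Conjugate primes have classes of the same order**: for `σ ∈ Gal(K/ℚ)` (`K` quadratic), `𝔭 ∤ f`,
`ord[σ𝔭]_f = ord[𝔭]_f` (`[σ𝔭] = [𝔭]⁻¹` for `σ ≠ 1`, the tree's
`RingClass.primeClass_mul_primeClass_eq_one_of_smul`). [cite: Cox2013, §7.B and §9.A Lemma 9.3] -/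
theorem orderOf_primeClass_eq_of_smul (h2 : finrank ℚ K = 2) (σ : K ≃ₐ[ℚ] K) (f : ℕ)
    {v w : HeightOneSpectrum (𝓞 K)} (hw : w.asIdeal = σ • v.asIdeal)
    (hv : ¬ Ideal.span {(f : 𝓞 K)} ≤ v.asIdeal) :
    orderOf (primeClass f w) = orderOf (primeClass f v) := by
  by_cases hσ : σ = 1
  · subst hσ
    rw [one_smul] at hw
    rw [HeightOneSpectrum.ext hw]
  · have h : primeClass f w = (primeClass f v)⁻¹ := eq_inv_of_mul_eq_one_right
      (Literature.NumberTheory.QuadraticFields.RingClass.primeClass_mul_primeClass_eq_one_of_smul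
        h2 σ hσ f hw hv)
    rw [h, orderOf_inv]

/-- **The primes of a quadratic field above a rational prime `q` are Galois conjugate** (transitivity of
`Gal(K/ℚ)` on the primes over `(q)`, Mathlib `Ideal.exists_smul_eq_of_isGaloisGroup`).
[cite: Marcus2018, Ch. 3, Thm. 23 (transitivity)] [cite: Cox2013, §9.A Lemma 9.3] -/
theorem exists_eq_smul_of_natCast_mem (h2 : finrank ℚ K = 2) {q : ℕ} (hq : q.Prime)
    {v w : HeightOneSpectrum (𝓞 K)} (hv : (q : 𝓞 K) ∈ v.asIdeal) (hw : (q : 𝓞 K) ∈ w.asIdeal) :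
    ∃ σ : K ≃ₐ[ℚ] K, w.asIdeal = σ • v.asIdeal := by
  classical
  haveI : Algebra.IsQuadraticExtension ℚ K := ⟨h2⟩
  haveI : IsGaloisGroup (K ≃ₐ[ℚ] K) ℤ (𝓞 K) :=
    IsGaloisGroup.of_isFractionRing (K ≃ₐ[ℚ] K) ℤ (𝓞 K) ℚ K
  have hmax : (Ideal.span {(q : ℤ)}).IsMaximal :=
    PrincipalIdealRing.isMaximal_of_irreducible (Nat.prime_iff_prime_int.mp hq).irreducible
  have hover : ∀ u : HeightOneSpectrum (𝓞 K), (q : 𝓞 K) ∈ u.asIdeal →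
      u.asIdeal.LiesOver (Ideal.span {(q : ℤ)}) := fun u hu => by
    constructor
    refine (hmax.eq_of_le (Ideal.IsPrime.under ℤ u.asIdeal).ne_top ?_)
    rw [Ideal.span_singleton_le_iff_mem, Ideal.under_def, Ideal.mem_comap, map_natCast]
    exact hu
  haveI := hover v hv
  haveI := hover w hw
  haveI := v.isPrime
  haveI := w.isPrime
  obtain ⟨σ, hσ⟩ := Ideal.exists_smul_eq_of_isGaloisGroup (Ideal.span {(q : ℤ)}) v.asIdeal w.asIdeal
    (K ≃ₐ[ℚ] K)
  exact ⟨σ, hσ.symm⟩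

omit [NumberField K] in
/-- A prime `v ∋ q` with `gcd(q, n) = 1` does not divide `n` (else `1 = aq + bn ∈ v`). [folklore] -/
theorem not_span_le_of_natCast_mem [NumberField K] {q n : ℕ} (hqn : q.Coprime n)
    {v : HeightOneSpectrum (𝓞 K)} (hqv : (q : 𝓞 K) ∈ v.asIdeal) :
    ¬ Ideal.span {(n : 𝓞 K)} ≤ v.asIdeal := fun hle => by
  have hn : (n : 𝓞 K) ∈ v.asIdeal := hle (Ideal.mem_span_singleton_self _)
  obtain ⟨a, b, hab⟩ := (Nat.isCoprime_iff_coprime.mpr hqn : IsCoprime (q : ℤ) (n : ℤ))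
  have hone : (1 : 𝓞 K) ∈ v.asIdeal := by
    have h := congrArg (fun z : ℤ => (z : 𝓞 K)) hab
    simp only [Int.cast_add, Int.cast_mul, Int.cast_natCast, Int.cast_one] at h
    rw [← h]
    exact Ideal.add_mem _ (Ideal.mul_mem_left _ _ hqv) (Ideal.mul_mem_left _ _ hn)
  exact v.isPrime.ne_top ((Ideal.eq_top_iff_one _).mpr hone)

/-- **The order condition at every prime above `q` from one of them**: if `q` is a rational prime
coprime to `m` and `n`, `v₀ ∋ q`, and `D · ord[𝔭_{v₀}]_m ∣ ord[𝔭_{v₀}]_n`, then the same holds at every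
prime `v ∋ q` of `K` (`v = σv₀`, orders are conjugation invariant) — the shape of the hypothesis `hord` of
`AuxInertLevel.auxiliaryInertLevel_conclusion_of_orderOf_dvd`. [cite: Cox2013, §9.A Lemma 9.3] -/
theorem forall_mul_orderOf_dvd_of_one (hK : IsImaginaryQuadratic K) {q : ℕ} (hq : q.Prime)
    {m n : ℕ} (hqm : q.Coprime m) (hqn : q.Coprime n) {D : ℕ}
    {v₀ : HeightOneSpectrum (𝓞 K)} (hv₀ : (q : 𝓞 K) ∈ v₀.asIdeal)
    (h : D * orderOf (primeClass m v₀) ∣ orderOf (primeClass n v₀)) :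
    ∀ v : HeightOneSpectrum (𝓞 K), ((q : ℕ) : 𝓞 K) ∈ v.asIdeal →
      D * orderOf (primeClass m v) ∣ orderOf (primeClass n v) := by
  intro v hv
  obtain ⟨σ, hσ⟩ := exists_eq_smul_of_natCast_mem hK.1 hq hv₀ hv
  rw [orderOf_primeClass_eq_of_smul hK.1 σ m hσ (not_span_le_of_natCast_mem hqm hv₀),
    orderOf_primeClass_eq_of_smul hK.1 σ n hσ (not_span_le_of_natCast_mem hqn hv₀)]
  exact h

end Summit.BirchSwinnertonDyer.BirchSwinnertonDyer.Theorems.AuxInertLevel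

end
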